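import Mathlib
import Literature.MathematicalPhysics.QuantumFieldTheory.Balaban1983to89.T4WilsonGaugeFlatDirection
import Literature.MathematicalPhysics.QuantumFieldTheory.Balaban1983to89.B12RegularClassInvariance263

/-!
# One-bond chains inside a plaquette window: bondwise perturbations and small gauge transformations
# (toolkit for the geometric stub `stub_innerWindowChains` of `BackwardLiouvilleRigidity.FlatRatioTermination`, stmt-QuantumFields-22542)

Route-independent lattice bookkeeping on the torus carrier `GaugeField P j G` of `Setup`, for ANY `[GaugeGroup G]` (only `dist1_mul_le`,
`dist1_conj`, `dist1_inv`, `dist1_one` are used).  A ONE-BOND CHAIN inside the window `PlaqSmall θ` from `A` to `B` of length `≤ N` is, verbatim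
as in the registered stub of the line `flat_ratio_termination` (planner ym-r3-idea-1 g10),
`∃ n W, n ≤ N ∧ W 0 = A ∧ W n = B ∧ (∀ i ≤ n, PlaqSmall θ (W i)) ∧ (∀ i < n, ∃ b, ∀ e ≠ b, W i e = W (i+1) e)` (no new definition is
introduced; every lemma spells the formula out).

* §2 `dist1_plaqHol_mul_le` / `dist1_plaqHol_le_of_bondwise`: multiplying every bond variable by a factor within `s` of `1` moves every
  plaquette variable by at most `4s` (`dist1_insert`: `dist1 (a g b) ≤ dist1 g + dist1 (a b)`).
* §3 `chain_trans`, `chain_symm`: composition and reversal of chains.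
* §4 `chain_of_bondwise`: a bondwise-`s`-small change of a configuration in `PlaqSmall θ₀` is a chain of `#PBond` one-bond moves inside
  `PlaqSmall θ` once `θ₀ + 4s ≤ θ` (change the bonds one at a time; every hybrid is again a bondwise-small change).
* §5 `chain_gaugeAct_of_small`: a gauge transformation `u` with every `u x` within `σ` of `1` is a chain of `#PBond` moves inside `PlaqSmall θ`
  once `θ₀ + 8σ ≤ θ` (gauge covariance of plaquette windows BY NAME: `T4WilsonGaugeFlatDirection.plaqHol_gaugeAct`,
  `B12RegularClassInvariance263.plaqSmall_gaugeAct_iff`), and `gaugeAct_mul'`.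
The `SU(2)` sequel (`…FlatRatioTerminationGaugeMovesSU2`: small `K`-th roots in `SU(2)`, hence EVERY gauge transformation is a chain, and pure
gauges are chains from `1`) imports this file.

HONEST SCOPE.  Helper lemmas `--supports stmt-QuantumFields-22542`; they do NOT prove the stub (whose content is a volume-uniform global gauge
theorem, see the sizing memo on the item), nor the support, the crux `ClassLimitTrajectories`, rung R3 or any summit statement; nothing here
bears on the Yang–Mills mass gap.
-/

namespace Summit.QuantumFields.YangMills.Theorems.FlatRatioTermination

open Literature.MathematicalPhysics.QuantumFieldTheory.Balaban1983to89

variable {P : Params} {j : ℕ} {G : Type*} [GaugeGroup G]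

/-! ## §2 Perturbing the bond variables moves the plaquette variables by at most four times as much -/

/-- INSERTION: `dist1 (a g b) ≤ dist1 g + dist1 (a b)` (`a g b = (a g a⁻¹)(a b)`). [folklore] -/
theorem dist1_insert (a g b : G) : GaugeGroup.dist1 (a * g * b) ≤ GaugeGroup.dist1 g + GaugeGroup.dist1 (a * b) := by
  have h : a * g * b = (a * g * a⁻¹) * (a * b) := by group
  rw [h]
  calc GaugeGroup.dist1 ((a * g * a⁻¹) * (a * b)) ≤ GaugeGroup.dist1 (a * g * a⁻¹) + GaugeGroup.dist1 (a * b) :=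
        GaugeGroup.dist1_mul_le _ _
    _ = GaugeGroup.dist1 g + GaugeGroup.dist1 (a * b) := by rw [GaugeGroup.dist1_conj]

/-- BONDWISE PERTURBATION: multiplying every bond variable on the left by a factor within `s` of `1` moves every plaquette
variable by at most `4s` in `dist1`. [folklore] -/
theorem dist1_plaqHol_mul_le (U : GaugeField P j G) (k : PBond P j → G) {s : ℝ} (hk : ∀ e, GaugeGroup.dist1 (k e) ≤ s)
    (p : Plaq P j) :
    GaugeGroup.dist1 (GaugeField.plaqHol (fun e => k e * U e) p) ≤ GaugeGroup.dist1 (GaugeField.plaqHol U p) + 4 * s := by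
  set e₁ : PBond P j := ⟨p.src, p.μ⟩
  set e₂ : PBond P j := ⟨p.src.shift p.μ, p.ν⟩
  set e₃ : PBond P j := ⟨p.src.shift p.ν, p.μ⟩
  set e₄ : PBond P j := ⟨p.src, p.ν⟩
  have hW : GaugeField.plaqHol (fun e => k e * U e) p =
      k e₁ * (U e₁ * k e₂ * ((U e₂ * (U e₃)⁻¹) * (k e₃)⁻¹ * ((U e₄)⁻¹ * (k e₄)⁻¹))) := by
    simp only [GaugeField.plaqHol, mul_inv_rev, e₁, e₂, e₃, e₄]; group
  have hU : GaugeField.plaqHol U p = U e₁ * U e₂ * (U e₃)⁻¹ * (U e₄)⁻¹ := rfl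
  rw [hW]
  have h1 := GaugeGroup.dist1_mul_le (k e₁) (U e₁ * k e₂ * ((U e₂ * (U e₃)⁻¹) * (k e₃)⁻¹ * ((U e₄)⁻¹ * (k e₄)⁻¹)))
  have h2 := dist1_insert (U e₁) (k e₂) ((U e₂ * (U e₃)⁻¹) * (k e₃)⁻¹ * ((U e₄)⁻¹ * (k e₄)⁻¹))
  have h3' : U e₁ * ((U e₂ * (U e₃)⁻¹) * (k e₃)⁻¹ * ((U e₄)⁻¹ * (k e₄)⁻¹)) =
      (U e₁ * U e₂ * (U e₃)⁻¹) * (k e₃)⁻¹ * ((U e₄)⁻¹ * (k e₄)⁻¹) := by group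
  have h3 := dist1_insert (U e₁ * U e₂ * (U e₃)⁻¹) (k e₃)⁻¹ ((U e₄)⁻¹ * (k e₄)⁻¹)
  have h4' : U e₁ * U e₂ * (U e₃)⁻¹ * ((U e₄)⁻¹ * (k e₄)⁻¹) = GaugeField.plaqHol U p * (k e₄)⁻¹ := by rw [hU]; group
  have h4 := GaugeGroup.dist1_mul_le (GaugeField.plaqHol U p) (k e₄)⁻¹
  rw [GaugeGroup.dist1_inv] at h3 h4
  rw [h3'] at h2
  rw [h4'] at h3
  linarith [hk e₁, hk e₂, hk e₃, hk e₄]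

/-- The same with the perturbed configuration given as `V` and the factors `V e (U e)⁻¹`. [folklore] -/
theorem dist1_plaqHol_le_of_bondwise (U V : GaugeField P j G) {s : ℝ} (hk : ∀ e, GaugeGroup.dist1 (V e * (U e)⁻¹) ≤ s)
    (p : Plaq P j) :
    GaugeGroup.dist1 (GaugeField.plaqHol V p) ≤ GaugeGroup.dist1 (GaugeField.plaqHol U p) + 4 * s := by
  have hV : V = fun e => (V e * (U e)⁻¹) * U e := funext fun e => by rw [inv_mul_cancel_right]
  rw [hV]
  exact dist1_plaqHol_mul_le U (fun e => V e * (U e)⁻¹) hk p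

/-! ## §3 One-bond chains inside a plaquette window: composition and reversal -/

/-- COMPOSITION of one-bond chains inside a window. [folklore] -/
theorem chain_trans {θ : ℝ} {A B C : GaugeField P j G} {N₁ N₂ : ℕ}
    (h₁ : ∃ (n : ℕ) (W : ℕ → GaugeField P j G), n ≤ N₁ ∧ W 0 = A ∧ W n = B ∧ (∀ i, i ≤ n → PlaqSmall θ (W i)) ∧
      (∀ i, i < n → ∃ b : PBond P j, ∀ e, e ≠ b → W i e = W (i + 1) e))
    (h₂ : ∃ (n : ℕ) (W : ℕ → GaugeField P j G), n ≤ N₂ ∧ W 0 = B ∧ W n = C ∧ (∀ i, i ≤ n → PlaqSmall θ (W i)) ∧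
      (∀ i, i < n → ∃ b : PBond P j, ∀ e, e ≠ b → W i e = W (i + 1) e)) :
    ∃ (n : ℕ) (W : ℕ → GaugeField P j G), n ≤ N₁ + N₂ ∧ W 0 = A ∧ W n = C ∧ (∀ i, i ≤ n → PlaqSmall θ (W i)) ∧
      (∀ i, i < n → ∃ b : PBond P j, ∀ e, e ≠ b → W i e = W (i + 1) e) := by
  obtain ⟨n₁, W₁, hn₁, hA, hB, hS₁, hst₁⟩ := h₁
  obtain ⟨n₂, W₂, hn₂, hB', hC, hS₂, hst₂⟩ := h₂
  refine ⟨n₁ + n₂, fun i => if i ≤ n₁ then W₁ i else W₂ (i - n₁), by omega, by simp [hA], ?_, ?_, ?_⟩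
  · by_cases h : n₂ = 0
    · subst h; simp [hB, ← hB', ← hC]
    · simp only [show ¬ (n₁ + n₂ ≤ n₁) by omega, if_false, Nat.add_sub_cancel_left, hC]
  · intro i hi
    by_cases h : i ≤ n₁
    · simp only [h, if_true]; exact hS₁ i h
    · simp only [h, if_false]; exact hS₂ (i - n₁) (by omega)
  · intro i hi
    dsimp only
    by_cases h : i + 1 ≤ n₁
    · obtain ⟨b, hb⟩ := hst₁ i (by omega)
      refine ⟨b, fun e he => ?_⟩
      rw [if_pos (show i ≤ n₁ by omega), if_pos h]
      exact hb e he
    · by_cases h' : i ≤ n₁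
      · -- `i = n₁`: the junction, `W₁ n₁ = B = W₂ 0`
        have hi₁ : i = n₁ := by omega
        subst hi₁
        obtain ⟨b, hb⟩ := hst₂ 0 (by omega)
        refine ⟨b, fun e he => ?_⟩
        rw [if_pos le_rfl, if_neg h, show i + 1 - i = 0 + 1 by omega, hB, ← hB']
        exact hb e he
      · obtain ⟨b, hb⟩ := hst₂ (i - n₁) (by omega)
        refine ⟨b, fun e he => ?_⟩
        rw [if_neg h', if_neg h, show i + 1 - n₁ = (i - n₁) + 1 by omega]
        exact hb e he

/-- REVERSAL of a one-bond chain inside a window. [folklore] -/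
theorem chain_symm {θ : ℝ} {A B : GaugeField P j G} {N : ℕ}
    (h : ∃ (n : ℕ) (W : ℕ → GaugeField P j G), n ≤ N ∧ W 0 = A ∧ W n = B ∧ (∀ i, i ≤ n → PlaqSmall θ (W i)) ∧
      (∀ i, i < n → ∃ b : PBond P j, ∀ e, e ≠ b → W i e = W (i + 1) e)) :
    ∃ (n : ℕ) (W : ℕ → GaugeField P j G), n ≤ N ∧ W 0 = B ∧ W n = A ∧ (∀ i, i ≤ n → PlaqSmall θ (W i)) ∧
      (∀ i, i < n → ∃ b : PBond P j, ∀ e, e ≠ b → W i e = W (i + 1) e) := by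
  obtain ⟨n, W, hn, hA, hB, hS, hst⟩ := h
  refine ⟨n, fun i => W (n - i), hn, by simp [hB], by simp [hA], fun i hi => hS (n - i) (by omega), ?_⟩
  intro i hi
  obtain ⟨b, hb⟩ := hst (n - (i + 1)) (by omega)
  refine ⟨b, fun e he => ?_⟩
  have := hb e he
  simp only [show n - (i + 1) + 1 = n - i by omega] at this
  exact this.symm

/-! ## §4 A bondwise-small change is a one-bond chain of length `#PBond` -/

/-- BONDWISE-SMALL CHANGES ARE CHAINS: if `PlaqSmall θ₀ A`, every factor `k e` is within `s` of `1` and `θ₀ + 4s ≤ θ`, then `A` is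
joined to `e ↦ k e · A e` by a chain of `#PBond` one-bond moves inside `PlaqSmall θ` (change the bonds one at a time, in any order;
every hybrid is a bondwise-small change of `A`). [folklore] -/
theorem chain_of_bondwise (θ₀ θ : ℝ) {s : ℝ} (hs : 0 ≤ s) (hθ : θ₀ + 4 * s ≤ θ) (A : GaugeField P j G) (hA : PlaqSmall θ₀ A)
    (k : PBond P j → G) (hk : ∀ e, GaugeGroup.dist1 (k e) ≤ s) :
    ∃ (n : ℕ) (W : ℕ → GaugeField P j G), n ≤ Fintype.card (PBond P j) ∧ W 0 = A ∧ W n = (fun e => k e * A e) ∧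
      (∀ i, i ≤ n → PlaqSmall θ (W i)) ∧ (∀ i, i < n → ∃ b : PBond P j, ∀ e, e ≠ b → W i e = W (i + 1) e) := by
  classical
  set m := Fintype.card (PBond P j)
  set ι : PBond P j ≃ Fin m := Fintype.equivFin (PBond P j)
  refine ⟨m, fun i e => if (ι e : ℕ) < i then k e * A e else A e, le_rfl, ?_, ?_, ?_, ?_⟩
  · funext e; simp
  · funext e; simp [(ι e).isLt]
  · intro i _ p
    have hyb : GaugeGroup.dist1 (GaugeField.plaqHol (fun e => (if (ι e : ℕ) < i then k e else 1) * A e) p) ≤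
        GaugeGroup.dist1 (GaugeField.plaqHol A p) + 4 * s :=
      dist1_plaqHol_mul_le A _ (fun e => by by_cases h : (ι e : ℕ) < i <;> simp [h, hk e, hs, GaugeGroup.dist1_one]) p
    have heq : (fun e => if (ι e : ℕ) < i then k e * A e else A e) =
        (fun e => (if (ι e : ℕ) < i then k e else 1) * A e) := by
      funext e; by_cases h : (ι e : ℕ) < i <;> simp [h]
    show GaugeGroup.dist1 (GaugeField.plaqHol (fun e => if (ι e : ℕ) < i then k e * A e else A e) p) < θ
    rw [heq]
    exact lt_of_le_of_lt hyb (by linarith [hA p])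
  · intro i hi
    refine ⟨ι.symm ⟨i, hi⟩, fun e he => ?_⟩
    have hne : (ι e : ℕ) ≠ i := by
      intro h
      apply he
      rw [← ι.symm_apply_apply e]
      congr 1
      exact Fin.ext h
    by_cases h : (ι e : ℕ) < i
    · simp [h, show (ι e : ℕ) < i + 1 by omega]
    · simp [h, show ¬ ((ι e : ℕ) < i + 1) by omega]

/-! ## §5 Gauge transformations -/

/-- Gauge transformations compose: `U^{u v} = (U^v)^u`. [folklore] -/
theorem gaugeAct_mul' (u v : GaugeTransf P j G) (U : GaugeField P j G) :
    GaugeField.gaugeAct (fun x => u x * v x) U = GaugeField.gaugeAct u (GaugeField.gaugeAct v U) := by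
  funext b
  simp only [GaugeField.gaugeAct, mul_inv_rev]
  group

/-- A SMALL GAUGE TRANSFORMATION IS A CHAIN: if every `u x` is within `σ` of `1`, `PlaqSmall θ₀ A` and `θ₀ + 8σ ≤ θ`, then `A` is joined to
`A^u` by `#PBond` one-bond moves inside `PlaqSmall θ`. [folklore] -/
theorem chain_gaugeAct_of_small (θ₀ θ : ℝ) {σ : ℝ} (hσ : 0 ≤ σ) (hθ : θ₀ + 8 * σ ≤ θ) (A : GaugeField P j G)
    (hA : PlaqSmall θ₀ A) (u : GaugeTransf P j G) (hu : ∀ x, GaugeGroup.dist1 (u x) ≤ σ) :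
    ∃ (n : ℕ) (W : ℕ → GaugeField P j G), n ≤ Fintype.card (PBond P j) ∧ W 0 = A ∧ W n = GaugeField.gaugeAct u A ∧
      (∀ i, i ≤ n → PlaqSmall θ (W i)) ∧ (∀ i, i < n → ∃ b : PBond P j, ∀ e, e ≠ b → W i e = W (i + 1) e) := by
  have hk : ∀ e : PBond P j, GaugeGroup.dist1 (u e.src * A e * (u e.tgt)⁻¹ * (A e)⁻¹) ≤ 2 * σ := by
    intro e
    have h1 : u e.src * A e * (u e.tgt)⁻¹ * (A e)⁻¹ = u e.src * (A e * (u e.tgt)⁻¹ * (A e)⁻¹) := by group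
    rw [h1]
    calc GaugeGroup.dist1 (u e.src * (A e * (u e.tgt)⁻¹ * (A e)⁻¹))
        ≤ GaugeGroup.dist1 (u e.src) + GaugeGroup.dist1 (A e * (u e.tgt)⁻¹ * (A e)⁻¹) := GaugeGroup.dist1_mul_le _ _
      _ = GaugeGroup.dist1 (u e.src) + GaugeGroup.dist1 (u e.tgt) := by
          rw [GaugeGroup.dist1_conj, GaugeGroup.dist1_inv]
      _ ≤ 2 * σ := by linarith [hu e.src, hu e.tgt]
  have hend : GaugeField.gaugeAct u A = fun e => (u e.src * A e * (u e.tgt)⁻¹ * (A e)⁻¹) * A e := by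
    funext e; simp [GaugeField.gaugeAct]
  rw [hend]
  exact chain_of_bondwise θ₀ θ (by linarith) (by linarith) A hA _ hk

end Summit.QuantumFields.YangMills.Theorems.FlatRatioTermination
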